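import Mathlib
import HarnessLib
import Summits.HubbardSuperconductivity.HubbardSuperconductivity.Theorems.KLProgrammeKLRegimeEngineTowerLevAssemblyKlEngFinal
import Summits.HubbardSuperconductivity.HubbardSuperconductivity.Theorems.KLProgrammeKLRegimeEngineTowerLevNumericsPackage

/-!
# Route `KLProgramme` — crux K3 ENGINE (stmt-HubbardSuperconductivity-20437 `KLRegimeEngineV17F2`), stub (b) v2, THE LEVELS PACKAGE (ℓ), numerics side
# «(ℓ)-NUMERICS-FINAL» (cell gate-hubbard-kl, seat p4 g21): THE LEVELS CLAUSE ON THE FLOW FRAME WITH THE MAIN TOWER'S NUMERICS DISCHARGED ON SHAPES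

`kernelNormsLevels_all_klEng_final (c″)` (k3c3-p2 g16, p696349) — stub (b)'s levels clause `∀ j ≤ n, KernelNormsLevels … (K_n) j` modulo E1 data + numerics —
composed with this lineage's `levNumerics_package` (…NumericsPackage), `exists_blockLen_klEng` and `exists_degreeCap`-style caps (…NumericsPins), and
`levNum_normV_le_two` (…NumericsBase).  **`kernelNormsLevels_all_klEng_num (c″)`** = p696349 with, on the MAIN tower (levels `d ≤ j ≤ n`):
* the blocking row GONE — the head reads `∃ Cκ CJ, … ∃ d₀ ≥ 2, ∀ d ≥ d₀, ∃ Cb, …` («(ℓ)-BLOCKLEN-CJ-UNIFORM»: `d₀ = d₀(C₂, CJ)`);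
* `∀ D, 3 ≤ D →` and the THREE degree caps GONE (chosen inside; block 0's Chernoff profile is therefore asked for every `m ≥ 4`, not only `m ≤ D`);
* `∀ B, 1 ≤ B →`, the row `B ≥ B₀`, the two coupling doors, the `hθ` row and the CE rows `∀ j, d ≤ j → j ≤ n → Qtot·ε_x²·B·max 1 (Atot j/ε_x) ≤ Qe.CE` GONE —
  replaced by: the SHAPE constants `κ₀ ρ₀ a₀ r₀ w₀ f₀ i₁ i₂ x₆` of the data suppliers (quantified right after the v1 doors), `∃ Bf uf CEf, 1 ≤ Bf ∧ 0 < uf ∧ 0 ≤ CEf`,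
  the doors `U ≤ uf/(2·Bf·P.Klam+1)`, `cc ≤ uf·log 4/(2·Bf·P.Klam+1)`, the shape rows `κ = κ₀ → αw = a₀(M/β) → ρ = ρ₀ → crw = r₀(M/β) → ccw = w₀(M/β) →
  Σ_z‖framePosKernel K_n z‖(1+|z|) ≤ f₀U →`, the import shapes `ι₂ ≤ i₂(M/β)³`, `X ≤ x₆(M/β)⁵`, `ι₁ ≤ i₁(M/β)`, and ONE threshold `CEf ≤ Qe.CE`; every other
  main-tower binder VERBATIM with `B := Bf`;
* block 0 (levels `1 ≤ j < d`, p3 g22) and level 0 (RO-3) VERBATIM with `B := Bf` (their smallness / CE rows are E1-data-shaped and stay hypotheses).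
So after this file the main tower's levels clause is typed MODULO E1 DATA ON SHAPES ONLY (base rows, frame weight, imports, six-leg cells, block-0/level-0 data).
Composition of landed theorems + the arithmetic `λ_j = Bf·Klam(|U|+U²j) ≤ uf` in the KL regime; nothing about the model is asserted beyond them; nothing asserts (ℓ),
any stub, K3 or superconductivity.
References: BGM 2006 §2.8 (2.76)–(2.84), (2.93)–(2.98), Lemma 2.5, §3 (3.2)–(3.8) [cite: BenfattoGiulianiMastropietro2006].
-/

noncomputable section

namespace Summit.HubbardSuperconductivity.HubbardSuperconductivity.Theorems.EngineV8

set_option linter.dupNamespace false -- summit = problem name (single-conjunct summit), D-0017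

open Classical
open Real Finset Literature.MathematicalPhysics.QuantumLattice Literature.Probability.LatticeModels GrassmannAlgebra
open Literature.Probability.LatticeModels.BattleFederbush
open Literature.MathematicalPhysics.QuantumLattice.FermiRG
open Summit.HubbardSuperconductivity.HubbardSuperconductivity.Theorems.KLProgrammeLegKernels
open Summit.HubbardSuperconductivity.HubbardSuperconductivity.Theorems.KLRegimeSplit
open Summit.HubbardSuperconductivity.HubbardSuperconductivity.Theorems.KLRegimeWick
open Summit.HubbardSuperconductivity.HubbardSuperconductivity.Theorems.TorusFourierL2
open Summit.HubbardSuperconductivity.HubbardSuperconductivity.Theorems.DispersionFlow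

variable {L M : ℕ} [NeZero L] [NeZero M]

omit [NeZero L] [NeZero M] in
/-- **Degree caps for every analysis family up to `n`**: one `D ≥ 3` with `card(SpaceTimeIdx L M × SectorLeg (sectorCount i))/2 ≤ D` for all `i ≤ n` and
`card (HubbardFieldIdx L M) ≤ 2D + 1`. [folklore] -/
theorem exists_degreeCap_all (L M n : ℕ) [NeZero L] [NeZero M] : ∃ D : ℕ, 3 ≤ D ∧
    (∀ i, i ≤ n → Fintype.card (SpaceTimeIdx L M × SectorLeg (sectorCount i)) / 2 ≤ D) ∧ Fintype.card (HubbardFieldIdx L M) ≤ 2 * D + 1 := by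
  refine ⟨3 + Fintype.card (HubbardFieldIdx L M) + ∑ i ∈ range (n + 1), Fintype.card (SpaceTimeIdx L M × SectorLeg (sectorCount i)),
    by omega, fun i hi => ?_, by omega⟩
  have hi' : i ∈ range (n + 1) := by rw [mem_range]; omega
  have hle : Fintype.card (SpaceTimeIdx L M × SectorLeg (sectorCount i)) ≤
      ∑ i ∈ range (n + 1), Fintype.card (SpaceTimeIdx L M × SectorLeg (sectorCount i)) :=
    single_le_sum (f := fun i => Fintype.card (SpaceTimeIdx L M × SectorLeg (sectorCount i))) (fun _ _ => Nat.zero_le _) hi'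
  omega

omit [NeZero L] in
/-- `β ≤ M` once `klEngM₃ β U L ≤ M`. [folklore] -/
theorem beta_le_of_klEngM₃_le {β U : ℝ} {L M : ℕ} (hM : klEngM₃ β U L ≤ M) : β ≤ M := by
  have h1 : β ≤ (⌈|β|⌉₊ : ℝ) := (le_abs_self β).trans (Nat.le_ceil _)
  have h2 : (⌈|β|⌉₊ : ℕ) ≤ klEngM₃ β U L := by
    unfold klEngM₃
    calc ⌈|β|⌉₊ ≤ (⌈|β|⌉₊ + 1) ^ 2 := by nlinarith [Nat.zero_le ⌈|β|⌉₊]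
      _ ≤ 2 ^ 10 * (⌈|β|⌉₊ + 1) ^ 2 := Nat.le_mul_of_pos_left _ (by norm_num)
      _ ≤ 2 ^ 10 * (⌈|β|⌉₊ + 1) ^ 2 * (L + 1) ^ 2 := Nat.le_mul_of_pos_right _ (by positivity)
  exact h1.trans (by exact_mod_cast h2.trans hM)

set_option maxHeartbeats 1600000 in -- one ~200-binder composition + the package's 32 closed forms
/-- **THE LEVELS CLAUSE ON THE FLOW FRAME, MAIN-TOWER NUMERICS DISCHARGED ON SHAPES** (see the module docstring for exactly which binders of
`kernelNormsLevels_all_klEng_final` are gone and what replaces them). [cite: BenfattoGiulianiMastropietro2006, §2.8 (2.76)-(2.84), (2.93)-(2.98), Lemma 2.5, §3 (3.2)-(3.8)] -/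
theorem kernelNormsLevels_all_klEng_num (c'' : ℝ) (hc'' : 0 < c'') :
    ∃ C₁ C₂ C₁' C₂' Cinc Dinc : ℝ, 0 < C₁ ∧ 0 < C₂ ∧ 0 < C₁' ∧ 0 < C₂' ∧ 0 < Cinc ∧ 1 ≤ Dinc ∧
    ∀ R : RenConsts, R.WF2 → ∃ c₃' : ℝ, 0 < c₃' ∧ ∃ U₀' : ℝ, 0 < U₀' ∧
      ∃ Cκ CJ : ℝ, 0 < Cκ ∧ 0 < CJ ∧ ∃ d₀ : ℕ, 2 ≤ d₀ ∧ ∀ d : ℕ, d₀ ≤ d → ∃ Cb : ℝ, 0 < Cb ∧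
      -- block 0's own constants (p3 g22's `kernelNormsLevels_blockZeroF_klEng d c''`): increment constants, thresholds, link triple — all indexed by `d`
      ∃ Cinc₀ Dinc₀ c₃'' U₀'' : ℝ, 0 < Cinc₀ ∧ 1 ≤ Dinc₀ ∧ 0 < c₃'' ∧ 0 < U₀'' ∧ ∃ Cκ₀ Cb₀ CJ₀ : ℝ, 0 < Cκ₀ ∧ 0 < Cb₀ ∧ 0 < CJ₀ ∧
      ∀ (G : GeoConsts) (P : SplitConsts) (Qh : EngConsts) (c : ℝ), P.WF → 0 < c → c ≤ klEngC₃6 P R → c ≤ c₃' → c ≤ c₃'' →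
      -- the SHAPE constants of the data suppliers (base rows, frame weight, imports), then the numerics' three numbers
      ∀ (κ₀ ρ₀ a₀ r₀ w₀ f₀ i₁ i₂ x₆ : ℝ), 0 < κ₀ → 0 < ρ₀ → 0 < a₀ → 0 < r₀ → 0 < w₀ → 0 ≤ f₀ → 0 ≤ i₁ → 0 ≤ i₂ → 0 ≤ x₆ →
      ∃ Bf uf CEf : ℝ, 1 ≤ Bf ∧ 0 < uf ∧ 0 ≤ CEf ∧
      ∀ μ ∈ klWindowC, ∀ U : ℝ, 0 < U → U ≤ klEngU₀9 P R c → U ≤ U₀' → U ≤ U₀'' → c'' * U ≤ 1 → U ≤ uf / (2 * Bf * P.Klam + 1) →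
      ∀ β : ℝ, klBetaMin ≤ β → β ≤ Real.exp (c / U ^ 2) →
      ∀ (L M : ℕ) [NeZero L] [NeZero M], klEngL₃ β U ≤ L → klEngM₃ β U L ≤ M →
      ∀ n : ℕ, 1 ≤ n → n ≤ nScales β + 1 → IsKLRegime U c (-(n : ℤ)) →
        HistP klPredsV17F2 L M G P Qh R β U μ 0 n → FrameOK R U (nScales β) μ (klFlowFrameU L M β U μ n) →
        (∀ m, 1 ≤ m → m < n → FlowPieceOscAt L M c'' β U μ m) →
      2 ≤ d →
      ∀ (cc : ℝ) (n' : ℕ), IsKLRegime U cc (-(n' : ℤ)) → n ≤ n' → cc ≤ uf * Real.log 4 / (2 * Bf * P.Klam + 1) →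
      -- p3's weighted grid step hypotheses at the cutoff `Λ_d`, analysis family `F_{d−1}`, rate `jw`
      ∀ (jw : ℕ) (κ : ℝ), 0 < κ →
        IsGramBoundedR ((hubbardGridSub L M β (2 * (2 * M))).transpose * hubbardCovAboveCT L M β μ 0 (klFlowFrameU L M β U μ n) (klScale klE0 d) *
          hubbardGridSub L M β (2 * (2 * M))) κ →
      ∀ (αw : ℝ), 0 < αw →
        (∀ X, ∑ Y, ‖((hubbardGridSub L M β (2 * (2 * M))).transpose * hubbardCovAboveCT L M β μ 0 (klFlowFrameU L M β U μ n) (klScale klE0 d) *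
          hubbardGridSub L M β (2 * (2 * M))) X Y‖ * gridLabelWt L (2 * (2 * M)) β {gridLegPos X, gridLegPos Y} ≤ αw) →
        (∀ Y, ∑ X, ‖((hubbardGridSub L M β (2 * (2 * M))).transpose * hubbardCovAboveCT L M β μ 0 (klFlowFrameU L M β U μ n) (klScale klE0 d) *
          hubbardGridSub L M β (2 * (2 * M))) X Y‖ * gridLabelWt L (2 * (2 * M)) β {gridLegPos X, gridLegPos Y} ≤ αw) →
      ∀ (ρ : ℝ), 0 < ρ →
      ∀ (crw ccw : ℝ), 0 < crw → 0 < ccw →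
        (∀ X'' : SpaceTimeIdx L M × SectorLeg (sectorCount (d - 1)), ∑ X' : GridLeg (GridPoint L (2 * (2 * M))),
          ‖(sectorAnalysisMatrix L M β (klAnisoFamily L M β μ (klFlowFrameU L M β U μ n) klE0 (d - 1)) * hubbardGridSub L M β (2 * (2 * M))) X'' X'‖ *
            gridLabelWt L (2 * (2 * M)) β {latticeLegPos (2 * (2 * M)) X'', gridLegPos X'} ≤ crw) →
        (∀ X' : GridLeg (GridPoint L (2 * (2 * M))), ∑ X'' : SpaceTimeIdx L M × SectorLeg (sectorCount (d - 1)),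
          ‖(sectorAnalysisMatrix L M β (klAnisoFamily L M β μ (klFlowFrameU L M β U μ n) klE0 (d - 1)) * hubbardGridSub L M β (2 * (2 * M))) X'' X'‖ *
            gridLabelWt L (2 * (2 * M)) β {latticeLegPos (2 * (2 * M)) X'', gridLegPos X'} ≤ ccw) →
      -- the base rows' SHAPES and the frame weight (numerics interface)
      κ = κ₀ → αw = a₀ * ((M : ℝ) / β) → ρ = ρ₀ → crw = r₀ * ((M : ℝ) / β) → ccw = w₀ * ((M : ℝ) / β) →
      (∑ z : TorusSite 2 L, ‖framePosKernel L (klFlowFrameU L M β U μ n) z‖ * (1 + torusSiteDist z 0)) ≤ f₀ * U →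
      -- the derived base constants (equational binders)
      ∀ (nV cF cg Ag Pg : ℝ),
        nV = normV (GridLeg (GridPoint L (2 * (2 * M)))) κ ρ
          (fun m' : ℕ => if m' = 1 then |β| / (2 * (2 * M) : ℕ) * ∑ z : TorusSite 2 L, ‖framePosKernel L (klFlowFrameU L M β U μ n) z‖ * (1 + torusSiteDist z 0)
            else if m' = 2 then |U| * |β| / (2 * (2 * M) : ℕ) else 0) →
        cF = (Real.exp 2 * (κ + ρ)) ^ (2 * 2) * (|β| / (2 * (2 * M) : ℕ)) → cg = Real.exp 1 * αw * cF / κ ^ 2 →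
        Ag = crw * Real.exp 1 * cF / (ccw * cg ^ 2) → Pg = ccw ^ 2 * cg / (ρ ^ 2 * (1 - Real.exp 1 * αw * nV / κ ^ 2)) →
      ∀ (ι₂ X : ℝ), 0 ≤ ι₂ → 0 ≤ X → ι₂ ≤ i₂ * ((M : ℝ) / β) ^ 3 → X ≤ x₆ * ((M : ℝ) / β) ^ 5 →
      ∀ (Ab Qb Ab' ι₂' X' : ℝ), Ab = (2 : ℝ) ^ (7 * (d - 1)) * Ag / P.Klam ^ 2 → Qb = Pg / (8 : ℝ) ^ (d - 1) →
        Ab' = Ab / Bf ^ 2 → ι₂' = ι₂ / Bf → X' = X / Bf ^ 2 →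
      -- the floor LINK data DISCHARGED on the flow frame (`linkDataPartialF_klEng'`): the four k-free constants pinned, the degree cap kept
      ∀ (κb αb crb ccb : ℝ), κb = Real.sqrt (2 * Cκ * klE0) → αb = Cb * ((M : ℝ) / β) * (4 : ℝ) ^ d / klE0 →
        crb = 81 * CJ * M / β → ccb = 162 * CJ * M / β →
      -- the law's six names PINNED by the link (equational binders), and the import `ι₁`
      ∀ (W Z σ Φ ψ τ ι₁ : ℝ), W = 64 * (27 : ℝ) ^ 4 * exp 2 * crb / ccb → Z = exp 4 * ccb ^ 2 * imagTimeWeight β M ^ 2 / 8 →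
        σ = κb ^ 2 / (exp 4 * ccb ^ 2) → Φ = 9 * αb * ccb / ((27 : ℝ) ^ 5 * exp 1 * κb ^ 2 * crb) → ψ = exp 4 * ccb ^ 2 / κb ^ 2 →
        τ = exp 2 * κb ^ 2 / ccb ^ 2 → 0 ≤ ι₁ → ι₁ ≤ i₁ * ((M : ℝ) / β) →
      ∀ (ρk Q' Q κA Yb Y A A' ι₃ : ℝ), ρk = max 4 (2 * τ * ψ) → Q' = Z * Qb + 1 → Q = ρk * Q' →
        κA = W * ((27 : ℝ) ^ 5 * (C₁ / C₂) * (8 : ℝ) ^ (d - 1)) →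
        Yb = ι₂ / (2 * Q') + W * Z ^ 3 * X / (4 * Q' ^ 2) + (W * (27 : ℝ) ^ 5 * Ab + κA * Ab) * Q' / 2 →
        Y = ι₂' / (2 * Q') + W * Z ^ 3 * X' / (4 * Q' ^ 2) + (W * (27 : ℝ) ^ 5 * Ab' + κA * Ab') * Q' / 2 →
        A = 2 * Y * (1 - ((2 : ℝ) ^ d)⁻¹) / (κA * Q') →
        A' = (W * (27 : ℝ) ^ 5 * Ab' + κA * Ab') + 2 * Y / Q' → ι₃ = W * Z ^ 3 * X' + A' * Q' ^ 3 →
      -- E1's imports and six-leg cells, block by block, each at the block's own base level `λ_{dk} = Bf·ε_{dk}` (monotone in the level)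
      (∀ k, 1 ≤ k → d * k ≤ n → W * Z ^ 1 * klTowerMuLevF L M β U μ (klFlowFrameU L M β U μ n) d k 1 ≤ ι₁ * (Bf * epsCoupling P U (d * k))) →
      (∀ k, 1 ≤ k → d * k ≤ n → W * Z ^ 2 * klTowerMuLevF L M β U μ (klFlowFrameU L M β U μ n) d k 2 ≤ ι₂' * (Bf * epsCoupling P U (d * k))) →
      (∀ k, 2 ≤ k → d * k ≤ n → klTowerMuLevAtF L M β U μ (klFlowFrameU L M β U μ n) d 0 k 3 ≤ X' * (Bf * epsCoupling P U (d * k)) ^ 2) →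
      -- the read-out constants (equational binders; `Atot` level by level through `λ_j = Bf·ε_j`), the public constant's threshold at every level `d ≤ j ≤ n`,
      -- the degree cap, the six-leg cells at every level `d ≤ j ≤ n`
      ∀ (Aro Qro Qtot : ℝ) (Atot : ℕ → ℝ), Aro = (27 : ℝ) ^ 5 * (C₁' / C₂') * (Ab' + (8 : ℝ) ^ (d - 1) * (A / (1 - ((2 : ℝ) ^ d)⁻¹))) →
        Qro = C₂' ^ 2 * max Qb (((2 : ℝ) ^ (d - 1))⁻¹ * max Q Qb) → Qtot = Dinc * max 1 (max Qro (max (4 * Q') (2 * τ * ψ * Q'))) →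
        (∀ j : ℕ, Atot j = Aro + Cinc * (A' * (4 * σ * (Bf * epsCoupling P U j) * Q' / (1 - 4 * σ * (Bf * epsCoupling P U j) * Q')) +
          exp 1 * (τ * (ι₁ * (Bf * epsCoupling P U j) + ι₂' / (2 * Q') + ι₃ / (4 * Q' ^ 2) + A' * Q' / 4)) *
            (Φ * (τ * (ι₁ * (Bf * epsCoupling P U j) + ι₂' / (2 * Q') + ι₃ / (4 * Q' ^ 2) + A' * Q' / 4)) /
              (1 - Φ * (τ * (ι₁ * (Bf * epsCoupling P U j) + ι₂' / (2 * Q') + ι₃ / (4 * Q' ^ 2) + A' * Q' / 4)))) / (2 * τ * Q'))) →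
      ∀ Qe : EngConsts, CEf ≤ Qe.CE →
      (∀ j : ℕ, 1 ≤ j → j ≤ n → ∀ Ωe : Fin (2 * 3) → Option (SectorLeg (sectorCount j)), levelCount Ωe = 1 →
        klAnisoLegKernelNormAt L M β U μ (klFlowFrameU L M β U μ n) klE0 j (2 * 3) Ωe ≤ Qe.CE ^ 3 * (epsCoupling P U j) ^ 2 * (2 : ℝ) ^ ((4 : ℤ) * j)) →
      -- THE LEVELS `1 ≤ j < d` (block 0, p3 g22's `kernelNormsLevels_blockZeroF_klEng`): the partition function at `Λ_1`, the level-0 datum of `𝒱_1[K_n]`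
      -- at `F_0` with its unit law AT `λ_1 = Bf·ε_1` (moved to the level inside), the kit cap at `sectorCount 0`, block 0's own pins, the Chernoff data and
      -- imports of `W₀·Z₀^m·klTowerMuLevF … 1 1 m` AT `λ_1`, the five smallness rows and the CE threshold at every level `1 ≤ j < d`
      hubbardEffPartitionFnCT L M β U μ 0 (klFlowFrameU L M β U μ n) (klScale klE0 1) ≠ 0 →
      ∀ (Ab₀ Qb₀ : ℝ), 0 ≤ Ab₀ → 0 ≤ Qb₀ →
      ∀ Nb₀ : Fin 5 → ℕ → ℝ, (∀ t p, 0 ≤ Nb₀ t p) →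
        (∀ (t : Fin 5) (p : ℕ) (Ωe' : Fin (2 * p) → Option (SectorLeg (sectorCount 0))), levelCount Ωe' = (t : ℕ) + 1 →
          klLevNormOf L M β μ (klFlowFrameU L M β U μ n) 0 (2 * p) (klTowerInput L M β U μ (klFlowFrameU L M β U μ n) 1 1) Ωe' ≤ Nb₀ t p) →
        (∀ (t : Fin 5) (p : ℕ), 3 ≤ p → Nb₀ t p / klLevUnitF β M t p 0 ≤ Ab₀ * (Bf * epsCoupling P U 1) ^ (p - 1) * Qb₀ ^ p) →
      ∀ (κb₀ αb₀ crb₀ ccb₀ : ℝ), κb₀ = Real.sqrt (2 * Cκ₀ * klE0) → αb₀ = Cb₀ * ((M : ℝ) / β) * (4 : ℝ) ^ d / klE0 →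
        crb₀ = 81 * CJ₀ * M / β → ccb₀ = 162 * CJ₀ * M / β →
      ∀ (W₀ Z₀ σ₀ Φ₀ ψ₀ τ₀ : ℝ), W₀ = 64 * (27 : ℝ) ^ 4 * exp 2 * crb₀ / ccb₀ → Z₀ = exp 4 * ccb₀ ^ 2 * imagTimeWeight β M ^ 2 / 8 →
        σ₀ = κb₀ ^ 2 / (exp 4 * ccb₀ ^ 2) → Φ₀ = 9 * αb₀ * ccb₀ / ((27 : ℝ) ^ 5 * exp 1 * κb₀ ^ 2 * crb₀) → ψ₀ = exp 4 * ccb₀ ^ 2 / κb₀ ^ 2 →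
        τ₀ = exp 2 * κb₀ ^ 2 / ccb₀ ^ 2 →
      ∀ (A'₀ Q'₀ ι₁₀ ι₂₀ ι₃₀ : ℝ), 0 ≤ A'₀ → 0 < Q'₀ →
      (∀ m, 4 ≤ m → W₀ * Z₀ ^ m * klTowerMuLevF L M β U μ (klFlowFrameU L M β U μ n) 1 1 m ≤ A'₀ * (Bf * epsCoupling P U 1) ^ (m - 1) * Q'₀ ^ m) →
      W₀ * Z₀ ^ 3 * klTowerMuLevF L M β U μ (klFlowFrameU L M β U μ n) 1 1 3 ≤ ι₃₀ * (Bf * epsCoupling P U 1) ^ 2 →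
      W₀ * Z₀ ^ 1 * klTowerMuLevF L M β U μ (klFlowFrameU L M β U μ n) 1 1 1 ≤ ι₁₀ * (Bf * epsCoupling P U 1) →
      W₀ * Z₀ ^ 2 * klTowerMuLevF L M β U μ (klFlowFrameU L M β U μ n) 1 1 2 ≤ ι₂₀ * (Bf * epsCoupling P U 1) →
      (∀ j : ℕ, 1 ≤ j → j < d → j ≤ n →
        4 * σ₀ * (Bf * epsCoupling P U j) * Q'₀ < 1 ∧ 2 * (Bf * epsCoupling P U j) * τ₀ * Q'₀ ≤ 1 ∧ exp 1 * τ₀ * (Bf * epsCoupling P U j) * Q'₀ < 1 ∧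
        Φ₀ * (τ₀ * (ι₁₀ * (Bf * epsCoupling P U j) + ι₂₀ / (2 * Q'₀) + ι₃₀ / (4 * Q'₀ ^ 2) + A'₀ * Q'₀ / 4)) < 1 ∧
        Φ₀ * (exp 1 * τ₀ * (ι₁₀ * (Bf * epsCoupling P U j)) + (exp 1 * τ₀) ^ 2 * (ι₂₀ * (Bf * epsCoupling P U j)) +
            (exp 1 * τ₀) ^ 3 * (ι₃₀ * (Bf * epsCoupling P U j) ^ 2) +
          A'₀ * (exp 1 * τ₀ * Q'₀) * ((exp 1 * τ₀ * (Bf * epsCoupling P U j) * Q'₀) ^ 3 / (1 - exp 1 * τ₀ * (Bf * epsCoupling P U j) * Q'₀))) < 1) →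
      ∀ (Aro₀ Qro₀ Qtot₀ : ℝ) (Atot₀ : ℕ → ℝ), Aro₀ = Cinc₀ * Ab₀ → Qro₀ = Dinc₀ * Qb₀ → Qtot₀ = Dinc₀ * max 1 (max Qro₀ (max (4 * Q'₀) (2 * τ₀ * ψ₀ * Q'₀))) →
        (∀ j : ℕ, Atot₀ j = Aro₀ + Cinc₀ * (A'₀ * (4 * σ₀ * (Bf * epsCoupling P U j) * Q'₀ / (1 - 4 * σ₀ * (Bf * epsCoupling P U j) * Q'₀)) +
          exp 1 * (τ₀ * (ι₁₀ * (Bf * epsCoupling P U j) + ι₂₀ / (2 * Q'₀) + ι₃₀ / (4 * Q'₀ ^ 2) + A'₀ * Q'₀ / 4)) *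
            (Φ₀ * (τ₀ * (ι₁₀ * (Bf * epsCoupling P U j) + ι₂₀ / (2 * Q'₀) + ι₃₀ / (4 * Q'₀ ^ 2) + A'₀ * Q'₀ / 4)) /
              (1 - Φ₀ * (τ₀ * (ι₁₀ * (Bf * epsCoupling P U j) + ι₂₀ / (2 * Q'₀) + ι₃₀ / (4 * Q'₀ ^ 2) + A'₀ * Q'₀ / 4)))) / (2 * τ₀ * Q'₀))) →
      (∀ j : ℕ, 1 ≤ j → j < d → j ≤ n → Qtot₀ * imagTimeWeight β M ^ 2 * Bf * max 1 (Atot₀ j / imagTimeWeight β M) ≤ Qe.CE) →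
      -- THE LEVEL `j = 0`: p3's weighted grid step at `(Λ_0, F_0)` (RO-3's closer `kernelNormsLevels_uvF_of_wgridStep` at `j = 0`)
      ∀ (jw0 : ℕ) (κ0 αw0 ρ0 crw0 ccw0 : ℝ), 0 < κ0 →
        IsGramBoundedR ((hubbardGridSub L M β (2 * (2 * M))).transpose * hubbardCovAboveCT L M β μ 0 (klFlowFrameU L M β U μ n) (klScale klE0 0) *
          hubbardGridSub L M β (2 * (2 * M))) κ0 →
        0 < αw0 →
        (∀ X, ∑ Y, ‖((hubbardGridSub L M β (2 * (2 * M))).transpose * hubbardCovAboveCT L M β μ 0 (klFlowFrameU L M β U μ n) (klScale klE0 0) *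
          hubbardGridSub L M β (2 * (2 * M))) X Y‖ * gridLabelWt L (2 * (2 * M)) β {gridLegPos X, gridLegPos Y} ≤ αw0) →
        (∀ Y, ∑ X, ‖((hubbardGridSub L M β (2 * (2 * M))).transpose * hubbardCovAboveCT L M β μ 0 (klFlowFrameU L M β U μ n) (klScale klE0 0) *
          hubbardGridSub L M β (2 * (2 * M))) X Y‖ * gridLabelWt L (2 * (2 * M)) β {gridLegPos X, gridLegPos Y} ≤ αw0) →
        0 < ρ0 →
        Real.exp 1 * αw0 * normV (GridLeg (GridPoint L (2 * (2 * M)))) κ0 ρ0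
          (fun m' : ℕ => if m' = 1 then |β| / (2 * (2 * M) : ℕ) * ∑ z : TorusSite 2 L, ‖framePosKernel L (klFlowFrameU L M β U μ n) z‖ * (1 + torusSiteDist z 0)
            else if m' = 2 then |U| * |β| / (2 * (2 * M) : ℕ) else 0) / κ0 ^ 2 < 1 →
        0 < crw0 → 0 < ccw0 →
        (∀ X'' : SpaceTimeIdx L M × SectorLeg (sectorCount 0), ∑ X' : GridLeg (GridPoint L (2 * (2 * M))),
          ‖(sectorAnalysisMatrix L M β (klAnisoFamily L M β μ (klFlowFrameU L M β U μ n) klE0 0) * hubbardGridSub L M β (2 * (2 * M))) X'' X'‖ *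
            gridLabelWt L (2 * (2 * M)) β {latticeLegPos (2 * (2 * M)) X'', gridLegPos X'} ≤ crw0) →
        (∀ X' : GridLeg (GridPoint L (2 * (2 * M))), ∑ X'' : SpaceTimeIdx L M × SectorLeg (sectorCount 0),
          ‖(sectorAnalysisMatrix L M β (klAnisoFamily L M β μ (klFlowFrameU L M β U μ n) klE0 0) * hubbardGridSub L M β (2 * (2 * M))) X'' X'‖ *
            gridLabelWt L (2 * (2 * M)) β {latticeLegPos (2 * (2 * M)) X'', gridLegPos X'} ≤ ccw0) →
      ∀ (nV0 cF0 cg0 Ag0 Pg0 Auv0 Quv0 : ℝ),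
        nV0 = normV (GridLeg (GridPoint L (2 * (2 * M)))) κ0 ρ0
          (fun m' : ℕ => if m' = 1 then |β| / (2 * (2 * M) : ℕ) * ∑ z : TorusSite 2 L, ‖framePosKernel L (klFlowFrameU L M β U μ n) z‖ * (1 + torusSiteDist z 0)
            else if m' = 2 then |U| * |β| / (2 * (2 * M) : ℕ) else 0) →
        cF0 = (Real.exp 2 * (κ0 + ρ0)) ^ (2 * 2) * (|β| / (2 * (2 * M) : ℕ)) → cg0 = Real.exp 1 * αw0 * cF0 / κ0 ^ 2 →
        Ag0 = crw0 * Real.exp 1 * cF0 / (ccw0 * cg0 ^ 2) → Pg0 = ccw0 ^ 2 * cg0 / (ρ0 ^ 2 * (1 - Real.exp 1 * αw0 * nV0 / κ0 ^ 2)) →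
        Auv0 = (2 : ℝ) ^ (7 * 0) * Ag0 / P.Klam ^ 2 / Bf ^ 2 → Quv0 = Pg0 / (8 : ℝ) ^ 0 →
        Quv0 * imagTimeWeight β M ^ 2 * Bf * max 1 (Auv0 / imagTimeWeight β M) ≤ Qe.CE →
      ∀ j : ℕ, j ≤ n → KernelNormsLevels L M P Qe β U μ (klFlowFrameU L M β U μ n) j := by
  obtain ⟨C₁, C₂, C₁', C₂', Cinc, Dinc, hC₁, hC₂, hC₁', hC₂', hCinc, hDinc, h⟩ := kernelNormsLevels_all_klEng_final c'' hc''
  refine ⟨C₁, C₂, C₁', C₂', Cinc, Dinc, hC₁, hC₂, hC₁', hC₂', hCinc, hDinc, fun R hR2 => ?_⟩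
  obtain ⟨c₃, hc₃, U₀, hU₀, Cκ, CJ, hCκ, hCJ, hd⟩ := h R hR2
  obtain ⟨d₀, hd₀2, hblk⟩ := exists_blockLen_klEng C₂ CJ
  refine ⟨c₃, hc₃, U₀, hU₀, Cκ, CJ, hCκ, hCJ, d₀, hd₀2, fun d hd₀d => ?_⟩
  obtain ⟨Cb, hCb, Cinc₀, Dinc₀, c₃'', U₀'', hCinc₀, hDinc₀, hc₃'', hU₀'', Cκ₀, Cb₀, CJ₀, hCκ₀, hCb₀, hCJ₀, h'⟩ := hd d
  refine ⟨Cb, hCb, Cinc₀, Dinc₀, c₃'', U₀'', hCinc₀, hDinc₀, hc₃'', hU₀'', Cκ₀, Cb₀, CJ₀, hCκ₀, hCb₀, hCJ₀, ?_⟩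
  intro G P Qh c hP hc hc6 hc₃' hc₃'' κ₀ ρ₀ a₀ r₀ w₀ f₀ i₁ i₂ x₆ hκ₀ hρ₀ ha₀ hr₀ hw₀ hf₀ hi₁ hi₂ hx₆
  have hd2 : 2 ≤ d := le_trans hd₀2 hd₀d
  have hK1 : 1 ≤ P.Klam := hP.1
  -- the 32 r-free closed forms of the package, as opaque local constants
  obtain ⟨pW, hpW⟩ : ∃ x : ℝ, x = 32 * (27 : ℝ) ^ 4 * exp 2 := ⟨_, rfl⟩
  obtain ⟨pZ, hpZ⟩ : ∃ x : ℝ, x = exp 4 * (81 * CJ) ^ 2 / 8 := ⟨_, rfl⟩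
  obtain ⟨ps, hps⟩ : ∃ x : ℝ, x = 2 * Cκ * klE0 / (exp 4 * 162 ^ 2 * CJ ^ 2) := ⟨_, rfl⟩
  obtain ⟨pt, hpt⟩ : ∃ x : ℝ, x = exp 2 * (2 * Cκ * klE0) / (162 ^ 2 * CJ ^ 2) := ⟨_, rfl⟩
  obtain ⟨pp, hpp⟩ : ∃ x : ℝ, x = exp 4 * 162 ^ 2 * CJ ^ 2 / (2 * Cκ * klE0) := ⟨_, rfl⟩
  obtain ⟨pφ, hpφ⟩ : ∃ x : ℝ, x = 9 * Cb * (4 : ℝ) ^ d / ((27 : ℝ) ^ 5 * exp 1 * Cκ * klE0 ^ 2) := ⟨_, rfl⟩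
  obtain ⟨pρ, hpρ⟩ : ∃ x : ℝ, x = 2 * exp 6 := ⟨_, rfl⟩
  obtain ⟨pκ, hpκ⟩ : ∃ x : ℝ, x = pW * ((27 : ℝ) ^ 5 * (C₁ / C₂) * (8 : ℝ) ^ (d - 1)) := ⟨_, rfl⟩
  obtain ⟨θ₁, hθ₁⟩ : ∃ x : ℝ, x = exp 1 * a₀ / (4 * κ₀ ^ 2) * ((exp 2 * (κ₀ + ρ₀)) ^ 2 * f₀ + (exp 2 * (κ₀ + ρ₀)) ^ 4) := ⟨_, rfl⟩
  obtain ⟨g₀, hg₀⟩ : ∃ x : ℝ, x = exp 1 * a₀ * (exp 2 * (κ₀ + ρ₀)) ^ 4 / (4 * κ₀ ^ 2) := ⟨_, rfl⟩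
  obtain ⟨A₀, hA₀⟩ : ∃ x : ℝ, x = exp 1 * r₀ * (exp 2 * (κ₀ + ρ₀)) ^ 4 / (4 * w₀ * g₀ ^ 2) := ⟨_, rfl⟩
  obtain ⟨P₀, hP₀⟩ : ∃ x : ℝ, x = w₀ ^ 2 * g₀ / ρ₀ ^ 2 := ⟨_, rfl⟩
  obtain ⟨ab, hab⟩ : ∃ x : ℝ, x = (2 : ℝ) ^ (7 * (d - 1)) * A₀ / P.Klam ^ 2 := ⟨_, rfl⟩
  obtain ⟨QL, hQL⟩ : ∃ x : ℝ, x = pZ * (P₀ / (8 : ℝ) ^ (d - 1)) := ⟨_, rfl⟩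
  obtain ⟨QH, hQH⟩ : ∃ x : ℝ, x = pZ * (2 * P₀ / (8 : ℝ) ^ (d - 1)) + 1 := ⟨_, rfl⟩
  obtain ⟨yB, hyB⟩ : ∃ x : ℝ, x = i₂ / (2 * QL) + pW * pZ ^ 3 * x₆ / (4 * QL ^ 2) + (pW * (27 : ℝ) ^ 5 + pκ) * ab * QH / 2 := ⟨_, rfl⟩
  obtain ⟨aPB, haPB⟩ : ∃ x : ℝ, x = (pW * (27 : ℝ) ^ 5 + pκ) * ab + 2 * yB / QL := ⟨_, rfl⟩
  obtain ⟨i₃B, hi₃B⟩ : ∃ x : ℝ, x = pW * pZ ^ 3 * x₆ + aPB * QH ^ 3 := ⟨_, rfl⟩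
  obtain ⟨sCB, hsCB⟩ : ∃ x : ℝ, x = i₂ / (2 * QL) + i₃B / (4 * QL ^ 2) + aPB * QH / 4 := ⟨_, rfl⟩
  obtain ⟨Bf, hBf⟩ : ∃ x : ℝ, x = max (max 1 (max (8 * pφ * pt * yB) (512 * exp 1 * pp ^ 3 * pt ^ 4 * pφ * pκ * yB / (3 * pρ ^ 3)))) (4 * pφ * pt * sCB) := ⟨_, rfl⟩
  obtain ⟨yP, hyP⟩ : ∃ x : ℝ, x = i₂ / (2 * Bf * QL) + pW * pZ ^ 3 * x₆ / (4 * Bf ^ 2 * QL ^ 2) + (pW * (27 : ℝ) ^ 5 + pκ) * ab * QH / (2 * Bf ^ 2) := ⟨_, rfl⟩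
  obtain ⟨yL, hyL⟩ : ∃ x : ℝ, x = (pW * (27 : ℝ) ^ 5 + pκ) * ab * QL / (2 * Bf ^ 2) := ⟨_, rfl⟩
  obtain ⟨aP, haP⟩ : ∃ x : ℝ, x = (pW * (27 : ℝ) ^ 5 + pκ) * ab / Bf ^ 2 + 2 * yP / QL := ⟨_, rfl⟩
  obtain ⟨aA, haA⟩ : ∃ x : ℝ, x = 2 * yP / (pκ * QL) := ⟨_, rfl⟩
  obtain ⟨aL, haL⟩ : ∃ x : ℝ, x = 3 * yL / (2 * pκ * QH) := ⟨_, rfl⟩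
  obtain ⟨i₃c, hi₃c⟩ : ∃ x : ℝ, x = pW * pZ ^ 3 * x₆ / Bf ^ 2 + aP * QH ^ 3 := ⟨_, rfl⟩
  obtain ⟨sC, hsC⟩ : ∃ x : ℝ, x = i₂ / (2 * Bf * QL) + i₃c / (4 * QL ^ 2) + aP * QH / 4 := ⟨_, rfl⟩
  obtain ⟨Sf, hSf⟩ : ∃ x : ℝ, x = exp 1 * pφ * pt * i₁ + exp 1 ^ 2 * pφ * pt ^ 2 * (i₂ / Bf) + exp 1 ^ 3 * pφ * pt ^ 3 * i₃c + pφ * aP * exp 1 ^ 2 * pt ^ 2 * QH ^ 2 / 2 := ⟨_, rfl⟩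
  obtain ⟨R₆, hR₆⟩ : ∃ x : ℝ, x = 1024 * ps * aP * QH / (aL * pρ ^ 3) := ⟨_, rfl⟩
  obtain ⟨R₇, hR₇⟩ : ∃ x : ℝ, x = 64 * exp 1 * pp ^ 3 * pt ^ 4 * pφ * QH ^ 2 * i₁ ^ 2 / (aL * pρ ^ 3 * QL ^ 3) := ⟨_, rfl⟩
  obtain ⟨uf, huf⟩ : ∃ x : ℝ, x = min (min 1 (min (1 / (8 * ps * QH + 1)) (min (1 / (2 * exp 1 * pt * QH + 1)) (min (1 / (4 * pφ * pt * i₁ + 1))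
      (min (1 / (2 * Sf + 1)) (min (1 / (R₆ + 1)) (1 / (R₇ + 1)))))))) (1 / (2 * θ₁ + 1)) := ⟨_, rfl⟩
  obtain ⟨qT, hqT⟩ : ∃ x : ℝ, x = Dinc * (1 + C₂' ^ 2 * (2 * (2 * P₀ / (8 : ℝ) ^ (d - 1)) + pρ * QH) + 4 * QH + 2 * pt * pp * QH) / 4 := ⟨_, rfl⟩
  obtain ⟨aT, haT⟩ : ∃ x : ℝ, x = (27 : ℝ) ^ 5 * (C₁' / C₂') * (ab / Bf ^ 2 + 4 / 3 * (8 : ℝ) ^ (d - 1) * aA) + Cinc * (aP + exp 1 * (i₁ + sC) / (2 * QL)) := ⟨_, rfl⟩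
  obtain ⟨CEf, hCEf⟩ : ∃ x : ℝ, x = qT * Bf * max 1 (2 * aT) := ⟨_, rfl⟩
  obtain ⟨hBf1, huf0, hCEf0, hpkg⟩ := levNumerics_package hC₁ hC₂ hC₁' hC₂' hCinc hDinc hCκ hCb hCJ hK1 hd2 hκ₀ hρ₀ ha₀ hr₀ hw₀ hf₀ hi₁ hi₂ hx₆
    hpW hpZ hps hpt hpp hpφ hpρ hpκ hθ₁ hg₀ hA₀ hP₀ hab hQL hQH hyB haPB hi₃B hsCB hBf hyP hyL haP haA haL hi₃c hsC hSf hR₆ hR₇ huf hqT haT hCEf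
  refine ⟨Bf, uf, CEf, hBf1, huf0, hCEf0, ?_⟩
  intro μ hμ U hU hU9 hU₀' hU₀'' hcU hUuf β hβmin hβc L M _ _ hL3 hM3 n hn1 hnN hreg hhist hfr hosc hd cc n' hreg' hnn' hccuf
    jw κ hκ hGB αw hαw hrow hcol ρ hρ crw ccw hcrw hccw hrow' hcol' hκs hαws hρs hcrws hccws hFf nV cF cg Ag Pg hnV hcF hcg hAg hPg
    ι₂ X hι₂ hX hι₂s hXs Ab Qb Ab' ι₂' X' hAb hQb hAb' hι₂' hX'
    κb αb crb ccb hκb hαb hcrb hccb W Z σ Φ ψ τ ι₁ hW hZ hσ hΦ hψ hτ hι₁ hι₁s ρk Q' Q κA Yb Y A A' ι₃ hρk hQ' hQ hκA hYb hY hA hA' hι₃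
    himp₁ himp₂ hcell Aro Qro Qtot Atot hAro hQro hQtot hAtot Qe hCE hsix
    hZ1 Ab₀ Qb₀ hAb₀ hQb₀ Nb₀ hNb₀0 hcar₀ hlawb₀ κb₀ αb₀ crb₀ ccb₀ hκb₀ hαb₀ hcrb₀ hccb₀ W₀ Z₀ σ₀ Φ₀ ψ₀ τ₀ hW₀ hZ₀ hσ₀ hΦ₀ hψ₀ hτ₀
    A'₀ Q'₀ ι₁₀ ι₂₀ ι₃₀ hA'₀ hQ'₀ hprof₀ hprof3₀ himp₁₀ himp₂₀ hsmall₀ Aro₀ Qro₀ Qtot₀ Atot₀ hAro₀ hQro₀ hQtot₀ hAtot₀ hCE₀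
    jw0 κ0 αw0 ρ0 crw0 ccw0 hκ0 hGB0 hαw0 hrow0 hcol0 hρ0 hθ0 hcrw0 hccw0 hrow0' hcol0' nV0 cF0 cg0 Ag0 Pg0 Auv0 Quv0 hnV0 hcF0 hcg0 hAg0 hPg0 hAuv0 hQuv0 hCEu0
    j hj
  have hβ : 0 < β := KLRegimeSplit.pos_of_klBetaMin_le hβmin
  have hβM : β ≤ M := beta_le_of_klEngM₃_le hM3
  have hM0 : (0 : ℝ) < M := Nat.cast_pos.2 (Nat.pos_of_ne_zero (NeZero.ne M))
  have hKl : 0 ≤ P.Klam := le_trans zero_le_one hK1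
  have hBf0 : 0 < Bf := lt_of_lt_of_le one_pos hBf1
  have hden : 0 < 2 * Bf * P.Klam + 1 := by positivity
  have hden1 : 1 ≤ 2 * Bf * P.Klam + 1 := by
    have h0 : 0 ≤ 2 * Bf * P.Klam := by positivity
    linarith
  have hUuf' : U ≤ uf := hUuf.trans (div_le_self huf0.le hden1)
  -- the degree caps
  obtain ⟨D, hD3, hDi, hcard⟩ := exists_degreeCap_all L M n
  have hDall : ∀ k, 1 ≤ k → d * k ≤ n → Fintype.card (SpaceTimeIdx L M × SectorLeg (sectorCount (d * k - 1))) / 2 ≤ D :=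
    fun k _ hk => hDi (d * k - 1) (by omega)
  have hD0 : Fintype.card (SpaceTimeIdx L M × SectorLeg (sectorCount 0)) / 2 ≤ D := hDi 0 (Nat.zero_le _)
  -- the field-weighted norm of the base profile
  have hdist0 : ∀ z : TorusSite 2 L, 0 ≤ torusSiteDist z 0 := fun z => by unfold torusSiteDist; exact Nat.cast_nonneg _
  have hF0 : 0 ≤ ∑ z : TorusSite 2 L, ‖framePosKernel L (klFlowFrameU L M β U μ n) z‖ * (1 + torusSiteDist z 0) :=
    sum_nonneg fun z _ => mul_nonneg (norm_nonneg _) (by linarith [hdist0 z])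
  have hnVle : nV ≤ (exp 2 * (κ + ρ)) ^ 2 * (|β| / (2 * (2 * M) : ℕ) * ∑ z : TorusSite 2 L, ‖framePosKernel L (klFlowFrameU L M β U μ n) z‖ * (1 + torusSiteDist z 0)) +
      (exp 2 * (κ + ρ)) ^ 4 * (|U| * |β| / (2 * (2 * M) : ℕ)) := by
    rw [hnV]
    refine (levNum_normV_le_two hκ.le hρ.le _ (fun m => ?_) (fun m hm1 hm2 => ?_)).trans (le_of_eq ?_)
    · by_cases h1 : m = 1
      · simp only [h1, if_true]; exact mul_nonneg (by positivity) hF0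
      · by_cases h2 : m = 2
        · simp only [h2, if_true]; positivity
        · simp only [h1, h2, if_false]; exact le_rfl
    · simp only [hm1, hm2, if_false]
    · simp
  have hnVnn : 0 ≤ nV := by
    rw [hnV]; exact normV_nonneg hκ.le hρ.le fun m => by
      by_cases h1 : m = 1
      · simp only [h1, if_true]; exact mul_nonneg (by positivity) hF0
      · by_cases h2 : m = 2
        · simp only [h2, if_true]; positivity
        · simp only [h1, h2, if_false]; exact le_rfl
  -- the package at these data
  obtain ⟨hθ, hBrow, hdoors, hCEpkg⟩ := hpkg β M hβ hβM U hU hUuf' _ hFf κ αw ρ crw ccw nV cF cg Ag Pg hκs hαws hρs hcrws hccws hnVnn hnVle hcF hcg hAg hPg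
    ι₂ X hι₂ hι₂s hX hXs Ab Qb Ab' ι₂' X' hAb hQb hAb' hι₂' hX' κb αb crb ccb hκb hαb hcrb hccb W Z σ Φ ψ τ ι₁ hW hZ hσ hΦ hψ hτ hι₁ hι₁s
    ρk Q' Q κA Yb Y A A' ι₃ hρk hQ' hQ hκA hYb hY hA hA' hι₃
  have hθ' : Real.exp 1 * αw * nV / κ ^ 2 < 1 := lt_of_le_of_lt hθ (by norm_num)
  have hθ'' : Real.exp 1 * αw * normV (GridLeg (GridPoint L (2 * (2 * M)))) κ ρ
      (fun m' : ℕ => if m' = 1 then |β| / (2 * (2 * M) : ℕ) * ∑ z : TorusSite 2 L, ‖framePosKernel L (klFlowFrameU L M β U μ n) z‖ * (1 + torusSiteDist z 0)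
        else if m' = 2 then |U| * |β| / (2 * (2 * M) : ℕ) else 0) / κ ^ 2 < 1 := by rw [← hnV]; exact hθ'
  -- the blocking row
  have hblock := hblk d hd₀d Cκ β M hCκ hCJ.ne' hβ.ne' hM0.ne' κb ccb Z ψ τ hκb hccb hZ hψ hτ
  -- the two doors
  have hlog : 0 < Real.log 4 := Real.log_pos (by norm_num)
  have hUdoor := hUuf.trans (div_le_div_of_nonneg_right hdoors hden.le)
  have hcdoor : cc ≤ min 1 (min (1 / (8 * σ * Q' + 1)) (min (1 / (2 * exp 1 * τ * Q' + 1)) (min (1 / (4 * Φ * τ * ι₁ + 1))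
        (min (1 / (2 * (Φ * (exp 1 * τ * ι₁ + (exp 1 * τ) ^ 2 * ι₂' + (exp 1 * τ) ^ 3 * ι₃ + A' * (exp 1 * τ * Q') ^ 2 / 2)) + 1))
          (min (A * Q ^ 3 / (16 * σ * Q' * A' * (4 * Q') ^ 3 + A * Q ^ 3))
            (A * Q ^ 3 / (16 * exp 1 * ψ * (2 * τ * ψ * Q') ^ 2 * Φ * τ ^ 2 * ι₁ ^ 2 + A * Q ^ 3))))))) * Real.log 4 / (2 * Bf * P.Klam + 1) :=
    hccuf.trans (div_le_div_of_nonneg_right (mul_le_mul_of_nonneg_right hdoors hlog.le) hden.le)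
  -- the coupling at every main level is below `uf`
  have hε0 : ∀ i, 0 ≤ epsCoupling P U i := fun i => by unfold epsCoupling; positivity
  have hlam : ∀ i, i ≤ n → Bf * epsCoupling P U i ≤ uf := by
    intro i hi
    have hin' : (i : ℝ) ≤ n' := Nat.cast_le.2 (hi.trans hnn')
    have hreg'' : U ^ 2 * (n' : ℝ) * Real.log 4 ≤ cc := by
      have h := hreg'
      simp only [IsKLRegime, Int.cast_neg, Int.cast_natCast, abs_neg, Nat.abs_cast] at h
      exact h
    have h1 : U ^ 2 * (i : ℝ) ≤ uf / (2 * Bf * P.Klam + 1) := by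
      have h2 : U ^ 2 * (n' : ℝ) ≤ cc / Real.log 4 := by rw [le_div_iff₀ hlog]; exact hreg''
      have h3 : cc / Real.log 4 ≤ uf / (2 * Bf * P.Klam + 1) := by
        rw [div_le_iff₀ hlog]
        calc cc ≤ uf * Real.log 4 / (2 * Bf * P.Klam + 1) := hccuf
          _ = uf / (2 * Bf * P.Klam + 1) * Real.log 4 := by ring
      calc U ^ 2 * (i : ℝ) ≤ U ^ 2 * (n' : ℝ) := by gcongr
        _ ≤ uf / (2 * Bf * P.Klam + 1) := h2.trans h3
    unfold epsCoupling
    rw [abs_of_pos hU]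
    calc Bf * (P.Klam * (U + U ^ 2 * (i : ℝ))) ≤ Bf * (P.Klam * (uf / (2 * Bf * P.Klam + 1) + uf / (2 * Bf * P.Klam + 1))) := by gcongr
      _ = uf * (2 * Bf * P.Klam / (2 * Bf * P.Klam + 1)) := by field_simp; ring
      _ ≤ uf * 1 := by
          refine mul_le_mul_of_nonneg_left ?_ huf0.le
          rw [div_le_one hden]; linarith
      _ = uf := mul_one _
  have hCEmain : ∀ i : ℕ, d ≤ i → i ≤ n → Qtot * imagTimeWeight β M ^ 2 * Bf * max 1 (Atot i / imagTimeWeight β M) ≤ Qe.CE :=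
    fun i _ hi => (hCEpkg (Bf * epsCoupling P U i) (mul_nonneg hBf0.le (hε0 i)) (hlam i hi) Aro Qro Qtot (Atot i) hAro hQro hQtot (hAtot i)).trans hCE
  -- the assembly of record
  exact h' G P Qh c hP hc hc6 hc₃' hc₃'' μ hμ U hU hU9 hU₀' hU₀'' hcU β hβmin hβc L M hL3 hM3 n hn1 hnN hreg hhist hfr hosc hd D hD3 cc n' hreg' hnn' Bf hBf1
    jw κ hκ hGB αw hαw hrow hcol ρ hρ hθ'' crw ccw hcrw hccw hrow' hcol' nV cF cg Ag Pg hnV hcF hcg hAg hPg ι₂ X hι₂ hX Ab Qb Ab' ι₂' X' hAb hQb hAb' hι₂' hX'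
    κb αb crb ccb hκb hαb hcrb hccb hDall W Z σ Φ ψ τ ι₁ hW hZ hσ hΦ hψ hτ hι₁ ρk Q' Q κA Yb Y A A' ι₃ hρk hQ' hQ hκA hYb hY hA hA' hι₃ hblock hBrow
    himp₁ himp₂ hcell hUdoor hcdoor Aro Qro Qtot Atot hAro hQro hQtot hAtot Qe hCEmain hcard hsix
    hZ1 Ab₀ Qb₀ hAb₀ hQb₀ Nb₀ hNb₀0 hcar₀ hlawb₀ hD0 κb₀ αb₀ crb₀ ccb₀ hκb₀ hαb₀ hcrb₀ hccb₀ W₀ Z₀ σ₀ Φ₀ ψ₀ τ₀ hW₀ hZ₀ hσ₀ hΦ₀ hψ₀ hτ₀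
    A'₀ Q'₀ ι₁₀ ι₂₀ ι₃₀ hA'₀ hQ'₀ (fun m hm _ => hprof₀ m hm) hprof3₀ himp₁₀ himp₂₀ hsmall₀ Aro₀ Qro₀ Qtot₀ Atot₀ hAro₀ hQro₀ hQtot₀ hAtot₀ hCE₀
    jw0 κ0 αw0 ρ0 crw0 ccw0 hκ0 hGB0 hαw0 hrow0 hcol0 hρ0 hθ0 hcrw0 hccw0 hrow0' hcol0' nV0 cF0 cg0 Ag0 Pg0 Auv0 Quv0 hnV0 hcF0 hcg0 hAg0 hPg0 hAuv0 hQuv0 hCEu0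
    j hj

end Summit.HubbardSuperconductivity.HubbardSuperconductivity.Theorems.EngineV8

end
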